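import Mathlib
import HarnessLib
import Summits.Ventures.LatticeQCDFlow.Exactness.IMHMultiProposalPoolEstimator

/-!
# The MULTIPLE-TRY flow sampler (Liu–Liang–Wong with independent proposals) is exact on a general state space: draw `n` proposals from the
# flow, select one `∝ w`, accept it with `min(1, Σ_i w(y_i) / (w(x) + Σ_{i ≠ J} w(y_i)))` — detailed balance for every positive measurable weight

HONEST FRAMING: exact (Metropolis-corrected) sampling algorithms for lattice gauge theory;
figures of merit are autocorrelation/cost numbers at stated couplings and volumes; no
continuum-physics claim.

Venture `LatticeQCDFlow` (cell pub-lqcd), topic `Exactness`; FANOUT row 30 (lean-1, GEN-42).  NEW WORK of the cell over Mathlib and GEN-41's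
`IMHMultiProposalExact` ∕ `IMHMultiProposalPoolEstimator` (Fubini through the first pool coordinate, coordinate permutations of `q^{⊗(n+1)}`,
`measurable_cons_comp`).  GEN-41 proved the OTHER batch rule
exact (pool selection among current-plus-proposals, i-SIR ∕ Barker at `n = 1`); this file does the multiple-try Metropolis rule with independent
proposals (MTM-IS; Metropolis at `n = 1`).  The tree's `Literature/…/MultipleTryMetropolis.lean`, `MultipleTryIndependenceSampler.lean` are
FINITE-state.  DEF-FREE: the sampler is any Markov kernel `P` satisfying the displayed equation (hypothesis `hP`), written on the pool
`c = (x, y_1, …, y_n)` with leave-one-out pool weights `S_k(c) = Σ_{i ≠ k} w(c_i)`: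
`P(x, B) = ∫ Σ_J w(y_J)·1_B(y_J)·min(S_0(c)⁻¹, S_{J+1}(c)⁻¹) dq^{⊗n}(y) + (1 − move(x))·1_B(x)` — and `sel_mul_acc_eq` certifies that
`w(y_J)·min(1/S_0, 1/S_{J+1})` IS the rule as run, `(w(y_J)/S_0)·min(1, S_0/S_{J+1})`: select `J ∝ w` among the proposals (`S_0 = Σ_i w(y_i)`),
accept with the MTM ratio (`S_{J+1} = w(x) + Σ_{i ≠ J} w(y_i)`).

## Results (no `sorry`, no new definitions)
* §1 `pool_term_swap_of_symm` — GEN-41's transposition symmetry with an extra factor `G` invariant under the swap `0 ↔ j`.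
* §2 `looPoolWeight_swap_zero`, `looPoolWeight_swap_self`, `mtmFactor_swap` — the MTM factor `min(S_0⁻¹, S_j⁻¹)` is swap-invariant;
  `measurable_mtmFactor`; `sel_mul_acc_eq` (the two algebraic forms of the rule agree); `mtm_move_le_one` (the move probability is `≤ 1`).
* §3 `mtm_setLIntegral_eq` — the mass flow `∫_A P(x, B) π(dx)` = a sum over `J` of swap-symmetric pool integrals + a diagonal term.
* §4 **`mtm_detailedBalance`** — `∫_A P(x, B) π(dx) = ∫_B P(x, A) π(dx)`: THE MULTIPLE-TRY FLOW SAMPLER IS REVERSIBLE FOR `π = w·q`, for every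
  positive measurable weight and every `n`; `mtm_apply_univ`; **`mtm_invariant`** — `π` is invariant.
* §5 `inv_poolWeight_le_mtmFactor`, **`multiProposal_apply_le_mtm_apply`** — for the same flow, weight and batch, `P_pool(x, B) ≤ P_MTM(x, B)` for
  every `B ∌ x`: the multiple-try rule moves at least as much as GEN-41's pool selection from every state (the off-diagonal domination that
  the Peskun–Tierney ordering of reversible kernels takes as hypothesis; the ordering itself is not formalised here).
Reading (gauge files): from a batch of `n` flow-generated gauge fields pick one with probability `∝ e^{−S}/q̃`, then accept it against the
current configuration with the multiple-try ratio; exact for the Wilson-type law whatever the flow — the second classical way (with GEN-41's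
pool selection) of spending a GPU batch on one exact update.  NOT CLAIMED: rates; the asymptotic-variance ordering between the two batch rules (only its off-diagonal hypothesis, §5).
-/

noncomputable section

namespace Summit.Ventures.LatticeQCDFlow.Exactness

open MeasureTheory ProbabilityTheory Function Finset
open scoped ENNReal

variable {Ω : Type*} [MeasurableSpace Ω] {q : Measure Ω} [IsProbabilityMeasure q] {w : Ω → ℝ} {n : ℕ}

/-! ## §1 The transposition symmetry with a swap-invariant factor -/

/-- Measurability of the weighted pool term `1_A(z_0)w(z_0)·w(z_j)1_B(z_j)·G(z)`. [ours, bookkeeping] -/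
theorem measurable_poolTermG (hw : Measurable w) {A B : Set Ω} (hA : MeasurableSet A) (hB : MeasurableSet B) (j : Fin (n + 1))
    {G : (Fin (n + 1) → Ω) → ℝ≥0∞} (hG : Measurable G) :
    Measurable fun z : Fin (n + 1) → Ω => A.indicator (fun _ => (1 : ℝ≥0∞)) (z 0) * ENNReal.ofReal (w (z 0)) *
      (ENNReal.ofReal (w (z j)) * B.indicator (fun _ => (1 : ℝ≥0∞)) (z j)) * G z :=
  ((((measurable_const.indicator hA).comp (measurable_pi_apply 0)).mul (hw.ennreal_ofReal.comp (measurable_pi_apply 0))).mul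
    ((hw.ennreal_ofReal.comp (measurable_pi_apply j)).mul ((measurable_const.indicator hB).comp (measurable_pi_apply j)))).mul hG

/-- **TRANSPOSITION SYMMETRY WITH A SWAP-INVARIANT FACTOR**: if `G(σ·z) = G(z)` for the transposition `σ = (0 j)`, then
`∫ 1_A(z_0)w(z_0)w(z_j)1_B(z_j)G(z) dq^{⊗(n+1)} = ∫ 1_B(z_0)w(z_0)w(z_j)1_A(z_j)G(z) dq^{⊗(n+1)}`. [ours] -/
theorem pool_term_swap_of_symm (hw : Measurable w) {A B : Set Ω} (hA : MeasurableSet A) (hB : MeasurableSet B) (j : Fin (n + 1))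
    {G : (Fin (n + 1) → Ω) → ℝ≥0∞} (hG : Measurable G)
    (hGσ : ∀ z, G ((MeasurableEquiv.piCongrLeft (fun _ : Fin (n + 1) => Ω) (Equiv.swap 0 j)) z) = G z) :
    ∫⁻ z, A.indicator (fun _ => (1 : ℝ≥0∞)) (z 0) * ENNReal.ofReal (w (z 0)) *
        (ENNReal.ofReal (w (z j)) * B.indicator (fun _ => (1 : ℝ≥0∞)) (z j)) * G z ∂(Measure.pi fun _ : Fin (n + 1) => q) =
      ∫⁻ z, B.indicator (fun _ => (1 : ℝ≥0∞)) (z 0) * ENNReal.ofReal (w (z 0)) *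
        (ENNReal.ofReal (w (z j)) * A.indicator (fun _ => (1 : ℝ≥0∞)) (z j)) * G z ∂(Measure.pi fun _ : Fin (n + 1) => q) := by
  set σ : Equiv.Perm (Fin (n + 1)) := Equiv.swap 0 j with hσ
  set e := MeasurableEquiv.piCongrLeft (fun _ : Fin (n + 1) => Ω) σ with he
  have hmp : MeasurePreserving e (Measure.pi fun _ : Fin (n + 1) => q) (Measure.pi fun _ : Fin (n + 1) => q) :=
    measurePreserving_piCongrLeft (fun _ : Fin (n + 1) => q) σ
  have h0 : ∀ z : Fin (n + 1) → Ω, e z 0 = z j := fun z => by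
    rw [he, piCongrLeft_apply_eq, hσ, Equiv.symm_swap, Equiv.swap_apply_left]
  have hj : ∀ z : Fin (n + 1) → Ω, e z j = z 0 := fun z => by
    rw [he, piCongrLeft_apply_eq, hσ, Equiv.symm_swap, Equiv.swap_apply_right]
  rw [← hmp.lintegral_comp (measurable_poolTermG hw hB hA j hG)]
  refine lintegral_congr fun z => ?_
  simp only [h0, hj, hGσ]
  ring

/-! ## §2 The multiple-try factor -/

omit [MeasurableSpace Ω] in
/-- The pool weight leaving out coordinate `0`, after the swap `(0 j)`, is the pool weight leaving out `j`. [ours, bookkeeping] -/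
theorem looPoolWeight_swap_zero [MeasurableSpace Ω] (j : Fin (n + 1)) (z : Fin (n + 1) → Ω) :
    ∑ i ∈ univ.erase 0, ENNReal.ofReal (w ((MeasurableEquiv.piCongrLeft (fun _ : Fin (n + 1) => Ω) (Equiv.swap 0 j)) z i)) =
      ∑ i ∈ univ.erase j, ENNReal.ofReal (w (z i)) := by
  simp_rw [piCongrLeft_apply_eq, Equiv.symm_swap]
  refine Finset.sum_equiv (Equiv.swap 0 j) (fun i => ?_) (fun i _ => rfl)
  simp only [mem_erase, mem_univ, and_true]
  rw [not_iff_not]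
  constructor
  · rintro rfl; exact Equiv.swap_apply_left _ _
  · intro h; rw [Equiv.swap_apply_eq_iff, Equiv.swap_apply_right] at h; exact h

omit [MeasurableSpace Ω] in
/-- … and the pool weight leaving out `j`, after the swap, is the one leaving out `0`. [ours, bookkeeping] -/
theorem looPoolWeight_swap_self [MeasurableSpace Ω] (j : Fin (n + 1)) (z : Fin (n + 1) → Ω) :
    ∑ i ∈ univ.erase j, ENNReal.ofReal (w ((MeasurableEquiv.piCongrLeft (fun _ : Fin (n + 1) => Ω) (Equiv.swap 0 j)) z i)) =
      ∑ i ∈ univ.erase 0, ENNReal.ofReal (w (z i)) := by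
  simp_rw [piCongrLeft_apply_eq, Equiv.symm_swap]
  refine Finset.sum_equiv (Equiv.swap 0 j) (fun i => ?_) (fun i _ => rfl)
  simp only [mem_erase, mem_univ, and_true]
  rw [not_iff_not]
  constructor
  · rintro rfl; exact Equiv.swap_apply_right _ _
  · intro h; rw [Equiv.swap_apply_eq_iff, Equiv.swap_apply_left] at h; exact h

omit [MeasurableSpace Ω] in
/-- **The MTM factor `min(S_0⁻¹, S_j⁻¹)` is invariant under the swap `(0 j)`.** [ours] -/
theorem mtmFactor_swap [MeasurableSpace Ω] (j : Fin (n + 1)) (z : Fin (n + 1) → Ω) :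
    min (∑ i ∈ univ.erase 0, ENNReal.ofReal (w ((MeasurableEquiv.piCongrLeft (fun _ : Fin (n + 1) => Ω) (Equiv.swap 0 j)) z i)))⁻¹
        (∑ i ∈ univ.erase j, ENNReal.ofReal (w ((MeasurableEquiv.piCongrLeft (fun _ : Fin (n + 1) => Ω) (Equiv.swap 0 j)) z i)))⁻¹ =
      min (∑ i ∈ univ.erase 0, ENNReal.ofReal (w (z i)))⁻¹ (∑ i ∈ univ.erase j, ENNReal.ofReal (w (z i)))⁻¹ := by
  rw [looPoolWeight_swap_zero, looPoolWeight_swap_self, min_comm]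

/-- Measurability of the MTM factor. [ours, bookkeeping] -/
theorem measurable_mtmFactor (hw : Measurable w) (j : Fin (n + 1)) :
    Measurable fun z : Fin (n + 1) → Ω =>
      min (∑ i ∈ univ.erase 0, ENNReal.ofReal (w (z i)))⁻¹ (∑ i ∈ univ.erase j, ENNReal.ofReal (w (z i)))⁻¹ :=
  (Finset.measurable_sum _ fun i _ => hw.ennreal_ofReal.comp (measurable_pi_apply i)).inv.min
    (Finset.measurable_sum _ fun i _ => hw.ennreal_ofReal.comp (measurable_pi_apply i)).inv

/-- **THE TWO FORMS OF THE RULE AGREE**: `(a/S)·min(1, S/T) = a·min(S⁻¹, T⁻¹)` for `S, T ∈ (0, ∞)` — select `∝ w` among the proposals, then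
accept with the multiple-try ratio. [ours, bookkeeping] -/
theorem sel_mul_acc_eq {a S T : ℝ≥0∞} (hS0 : S ≠ 0) (hST : S ≠ ⊤) :
    a / S * min 1 (S / T) = a * min S⁻¹ T⁻¹ := by
  rcases le_total S T with h | h
  · -- `S ≤ T`: the acceptance is `S/T`, the factor is `T⁻¹`
    rw [min_eq_right (ENNReal.div_le_of_le_mul (by rwa [one_mul])), min_eq_right (ENNReal.inv_le_inv.2 h), div_eq_mul_inv, div_eq_mul_inv,
      mul_assoc, ← mul_assoc S⁻¹, ENNReal.inv_mul_cancel hS0 hST, one_mul]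
  · -- `T ≤ S`: the acceptance is `1`, the factor is `S⁻¹`
    rw [min_eq_left ((ENNReal.le_div_iff_mul_le (Or.inr hS0) (Or.inr hST)).2 (by rwa [one_mul])), min_eq_left (ENNReal.inv_le_inv.2 h),
      mul_one, div_eq_mul_inv]

omit [MeasurableSpace Ω] in
/-- The leave-out-`0` pool weight of `x ∷ y` is the proposals' total weight. [ours, bookkeeping] -/
theorem looPoolWeight_zero_cons (x : Ω) (y : Fin n → Ω) :
    ∑ i ∈ univ.erase 0, ENNReal.ofReal (w (Fin.cons (α := fun _ : Fin (n + 1) => Ω) x y i)) = ∑ J, ENNReal.ofReal (w (y J)) := by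
  have h1 := Finset.add_sum_erase (univ : Finset (Fin (n + 1)))
    (fun i => ENNReal.ofReal (w (Fin.cons (α := fun _ : Fin (n + 1) => Ω) x y i))) (mem_univ 0)
  rw [Fin.sum_univ_succ] at h1
  simp only [Fin.cons_zero, Fin.cons_succ] at h1
  exact (ENNReal.add_right_inj ENNReal.ofReal_ne_top).1 h1

omit [MeasurableSpace Ω] in
/-- **The move probability integrand is at most one**: `Σ_J w(y_J)·min(S_0⁻¹, S_{J+1}⁻¹) ≤ Σ_J w(y_J)/S_0 = 1` (and `= 0 ≤ 1` for `n = 0`). [ours] -/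
theorem mtm_move_le_one (hw0 : ∀ y, 0 < w y) (x : Ω) (y : Fin n → Ω) :
    ∑ J : Fin n, ENNReal.ofReal (w (Fin.cons (α := fun _ : Fin (n + 1) => Ω) x y J.succ)) *
        min (∑ i ∈ univ.erase 0, ENNReal.ofReal (w (Fin.cons (α := fun _ : Fin (n + 1) => Ω) x y i)))⁻¹
          (∑ i ∈ univ.erase J.succ, ENNReal.ofReal (w (Fin.cons (α := fun _ : Fin (n + 1) => Ω) x y i)))⁻¹ ≤ 1 := by
  simp only [Fin.cons_succ, looPoolWeight_zero_cons]
  set S := ∑ J, ENNReal.ofReal (w (y J)) with hS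
  rcases Nat.eq_zero_or_pos n with hn | hn
  · subst hn; simp
  · have hS0 : S ≠ 0 := by
      haveI : Nonempty (Fin n) := ⟨⟨0, hn⟩⟩
      rw [hS]
      intro h0
      have := (Finset.sum_eq_zero_iff.1 h0) ⟨0, hn⟩ (mem_univ _)
      exact absurd this (ne_of_gt (ENNReal.ofReal_pos.2 (hw0 _)))
    have hST : S ≠ ⊤ := ENNReal.sum_ne_top.2 fun i _ => ENNReal.ofReal_ne_top
    calc ∑ J : Fin n, ENNReal.ofReal (w (y J)) * min S⁻¹
            (∑ i ∈ univ.erase J.succ, ENNReal.ofReal (w (Fin.cons (α := fun _ : Fin (n + 1) => Ω) x y i)))⁻¹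
        ≤ ∑ J : Fin n, ENNReal.ofReal (w (y J)) * S⁻¹ := sum_le_sum fun J _ => mul_le_mul' le_rfl (min_le_left _ _)
      _ = S * S⁻¹ := by rw [← sum_mul]
      _ = 1 := ENNReal.mul_inv_cancel hS0 hST

/-! ## §3 The mass flow of the multiple-try kernel -/

/-- **THE POOL REPRESENTATION OF THE MASS FLOW**: for the multiple-try kernel,
`∫_A P(x, B) π(dx) = Σ_J ∫ 1_A(z_0)w(z_0)·w(z_{J+1})1_B(z_{J+1})·min(S_0⁻¹, S_{J+1}⁻¹) dq^{⊗(n+1)} + ∫_{B ∩ A} w(x)(1 − move(x)) q(dx)`. [ours] -/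
theorem mtm_setLIntegral_eq (hw : Measurable w) (P : Kernel Ω Ω)
    (hP : ∀ (x : Ω) {B : Set Ω}, MeasurableSet B → P x B =
      ∫⁻ y, ∑ J : Fin n, ENNReal.ofReal (w (Fin.cons (α := fun _ : Fin (n + 1) => Ω) x y J.succ)) *
          B.indicator (fun _ => (1 : ℝ≥0∞)) (Fin.cons (α := fun _ : Fin (n + 1) => Ω) x y J.succ) *
          min (∑ i ∈ univ.erase 0, ENNReal.ofReal (w (Fin.cons (α := fun _ : Fin (n + 1) => Ω) x y i)))⁻¹
            (∑ i ∈ univ.erase J.succ, ENNReal.ofReal (w (Fin.cons (α := fun _ : Fin (n + 1) => Ω) x y i)))⁻¹ ∂(Measure.pi fun _ : Fin n => q) +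
        (1 - ∫⁻ y, ∑ J : Fin n, ENNReal.ofReal (w (Fin.cons (α := fun _ : Fin (n + 1) => Ω) x y J.succ)) *
          min (∑ i ∈ univ.erase 0, ENNReal.ofReal (w (Fin.cons (α := fun _ : Fin (n + 1) => Ω) x y i)))⁻¹
            (∑ i ∈ univ.erase J.succ, ENNReal.ofReal (w (Fin.cons (α := fun _ : Fin (n + 1) => Ω) x y i)))⁻¹ ∂(Measure.pi fun _ : Fin n => q)) *
          B.indicator 1 x)
    {A B : Set Ω} (hA : MeasurableSet A) (hB : MeasurableSet B) :
    ∫⁻ x in A, P x B ∂(q.withDensity fun x => ENNReal.ofReal (w x)) =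
      (∑ J : Fin n, ∫⁻ z, A.indicator (fun _ => (1 : ℝ≥0∞)) (z 0) * ENNReal.ofReal (w (z 0)) *
          (ENNReal.ofReal (w (z J.succ)) * B.indicator (fun _ => (1 : ℝ≥0∞)) (z J.succ)) *
          min (∑ i ∈ univ.erase 0, ENNReal.ofReal (w (z i)))⁻¹ (∑ i ∈ univ.erase J.succ, ENNReal.ofReal (w (z i)))⁻¹
          ∂(Measure.pi fun _ : Fin (n + 1) => q)) +
      ∫⁻ x in B ∩ A, ENNReal.ofReal (w x) * (1 - ∫⁻ y, ∑ J : Fin n, ENNReal.ofReal (w (Fin.cons (α := fun _ : Fin (n + 1) => Ω) x y J.succ)) *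
          min (∑ i ∈ univ.erase 0, ENNReal.ofReal (w (Fin.cons (α := fun _ : Fin (n + 1) => Ω) x y i)))⁻¹
            (∑ i ∈ univ.erase J.succ, ENNReal.ofReal (w (Fin.cons (α := fun _ : Fin (n + 1) => Ω) x y i)))⁻¹ ∂(Measure.pi fun _ : Fin n => q)) ∂q := by
  -- names for the integrands
  set T : Ω → (Fin n → Ω) → Fin n → Set Ω → ℝ≥0∞ := fun x y J C =>
    ENNReal.ofReal (w (Fin.cons (α := fun _ : Fin (n + 1) => Ω) x y J.succ)) *
      C.indicator (fun _ => (1 : ℝ≥0∞)) (Fin.cons (α := fun _ : Fin (n + 1) => Ω) x y J.succ) *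
      min (∑ i ∈ univ.erase 0, ENNReal.ofReal (w (Fin.cons (α := fun _ : Fin (n + 1) => Ω) x y i)))⁻¹
        (∑ i ∈ univ.erase J.succ, ENNReal.ofReal (w (Fin.cons (α := fun _ : Fin (n + 1) => Ω) x y i)))⁻¹ with hT
  set M : Ω → ℝ≥0∞ := fun x => ∫⁻ y, ∑ J : Fin n, ENNReal.ofReal (w (Fin.cons (α := fun _ : Fin (n + 1) => Ω) x y J.succ)) *
      min (∑ i ∈ univ.erase 0, ENNReal.ofReal (w (Fin.cons (α := fun _ : Fin (n + 1) => Ω) x y i)))⁻¹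
        (∑ i ∈ univ.erase J.succ, ENNReal.ofReal (w (Fin.cons (α := fun _ : Fin (n + 1) => Ω) x y i)))⁻¹ ∂(Measure.pi fun _ : Fin n => q)
    with hM
  -- joint measurability of the pool integrands
  have hGJ : ∀ (J : Fin n) {C : Set Ω}, MeasurableSet C → Measurable fun z : Fin (n + 1) → Ω =>
      ENNReal.ofReal (w (z J.succ)) * C.indicator (fun _ => (1 : ℝ≥0∞)) (z J.succ) *
        min (∑ i ∈ univ.erase 0, ENNReal.ofReal (w (z i)))⁻¹ (∑ i ∈ univ.erase J.succ, ENNReal.ofReal (w (z i)))⁻¹ := fun J C hC =>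
    ((hw.ennreal_ofReal.comp (measurable_pi_apply _)).mul ((measurable_const.indicator hC).comp (measurable_pi_apply _))).mul
      (measurable_mtmFactor hw J.succ)
  have hTm : ∀ {C : Set Ω}, MeasurableSet C → Measurable (Function.uncurry fun x y => ∑ J, T x y J C) := fun {C} hC => by
    refine Finset.measurable_sum _ fun J _ => ?_
    simp only [hT]
    exact measurable_cons_comp (hGJ J hC)
  have hMm : Measurable M := by
    have h := @hTm Set.univ MeasurableSet.univ
    simp only [hT, Set.indicator_univ, mul_one] at h
    exact h.lintegral_prod_right'
  have hKm : Measurable fun x => P x B := Kernel.measurable_coe _ hB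
  rw [setLIntegral_withDensity_eq_setLIntegral_mul _ hw.ennreal_ofReal hKm hA]
  simp only [Pi.mul_apply]
  have hpt : ∀ x, ENNReal.ofReal (w x) * P x B =
      ENNReal.ofReal (w x) * (∫⁻ y, ∑ J, T x y J B ∂(Measure.pi fun _ : Fin n => q)) +
        B.indicator (fun x => ENNReal.ofReal (w x) * (1 - M x)) x := by
    intro x
    rw [hP x hB, mul_add]
    congr 1
    by_cases hx : x ∈ B
    · rw [Set.indicator_of_mem hx, Set.indicator_of_mem hx, Pi.one_apply, mul_one]
    · rw [Set.indicator_of_notMem hx, Set.indicator_of_notMem hx, mul_zero, mul_zero]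
  simp_rw [hpt]
  have hind : Measurable (B.indicator fun x => ENNReal.ofReal (w x) * (1 - M x)) :=
    (hw.ennreal_ofReal.mul (measurable_const.sub hMm)).indicator hB
  rw [lintegral_add_right _ hind, lintegral_indicator hB, Measure.restrict_restrict hB]
  congr 1
  -- the moving part in pool coordinates
  rw [← lintegral_indicator hA]
  have hF : ∀ J : Fin n, Measurable fun z : Fin (n + 1) → Ω => A.indicator (fun _ => (1 : ℝ≥0∞)) (z 0) * ENNReal.ofReal (w (z 0)) *
      (ENNReal.ofReal (w (z J.succ)) * B.indicator (fun _ => (1 : ℝ≥0∞)) (z J.succ)) *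
      min (∑ i ∈ univ.erase 0, ENNReal.ofReal (w (z i)))⁻¹ (∑ i ∈ univ.erase J.succ, ENNReal.ofReal (w (z i)))⁻¹ := fun J =>
    measurable_poolTermG hw hA hB J.succ (measurable_mtmFactor hw J.succ)
  rw [← lintegral_finsetSum _ fun J _ => hF J, lintegral_pi_succ_eq_lintegral_cons q n (Finset.measurable_sum _ fun J _ => hF J)]
  refine lintegral_congr fun x => ?_
  by_cases hx : x ∈ A
  · rw [Set.indicator_of_mem hx]
    simp only [Fin.cons_zero, Set.indicator_of_mem hx, one_mul]
    rw [← lintegral_const_mul _ (by simpa [hT] using (hTm hB).of_uncurry_left (x := x))]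
    refine lintegral_congr fun y => ?_
    rw [Finset.mul_sum]
    refine sum_congr rfl fun J _ => ?_
    simp only [hT]
    ring
  · rw [Set.indicator_of_notMem hx]
    simp only [Fin.cons_zero, Set.indicator_of_notMem hx, zero_mul, Finset.sum_const_zero, lintegral_const, zero_mul]

/-! ## §4 Detailed balance and invariance -/

/-- **THE MULTIPLE-TRY FLOW SAMPLER IS IN DETAILED BALANCE WITH `π = w·q`**, for every positive measurable weight, every `n` and every Markov
kernel `P` satisfying the multiple-try equation. [ours] -/
theorem mtm_detailedBalance (hw : Measurable w) (P : Kernel Ω Ω)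
    (hP : ∀ (x : Ω) {B : Set Ω}, MeasurableSet B → P x B =
      ∫⁻ y, ∑ J : Fin n, ENNReal.ofReal (w (Fin.cons (α := fun _ : Fin (n + 1) => Ω) x y J.succ)) *
          B.indicator (fun _ => (1 : ℝ≥0∞)) (Fin.cons (α := fun _ : Fin (n + 1) => Ω) x y J.succ) *
          min (∑ i ∈ univ.erase 0, ENNReal.ofReal (w (Fin.cons (α := fun _ : Fin (n + 1) => Ω) x y i)))⁻¹
            (∑ i ∈ univ.erase J.succ, ENNReal.ofReal (w (Fin.cons (α := fun _ : Fin (n + 1) => Ω) x y i)))⁻¹ ∂(Measure.pi fun _ : Fin n => q) +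
        (1 - ∫⁻ y, ∑ J : Fin n, ENNReal.ofReal (w (Fin.cons (α := fun _ : Fin (n + 1) => Ω) x y J.succ)) *
          min (∑ i ∈ univ.erase 0, ENNReal.ofReal (w (Fin.cons (α := fun _ : Fin (n + 1) => Ω) x y i)))⁻¹
            (∑ i ∈ univ.erase J.succ, ENNReal.ofReal (w (Fin.cons (α := fun _ : Fin (n + 1) => Ω) x y i)))⁻¹ ∂(Measure.pi fun _ : Fin n => q)) *
          B.indicator 1 x)
    {A B : Set Ω} (hA : MeasurableSet A) (hB : MeasurableSet B) :
    ∫⁻ x in A, P x B ∂(q.withDensity fun x => ENNReal.ofReal (w x)) = ∫⁻ x in B, P x A ∂(q.withDensity fun x => ENNReal.ofReal (w x)) := by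
  rw [mtm_setLIntegral_eq hw P hP hA hB, mtm_setLIntegral_eq hw P hP hB hA, Set.inter_comm]
  congr 1
  refine sum_congr rfl fun J _ => ?_
  exact pool_term_swap_of_symm hw hA hB J.succ (measurable_mtmFactor hw J.succ) (fun z => mtmFactor_swap J.succ z)

/-- The multiple-try kernel has total mass one. [ours, bookkeeping] -/
theorem mtm_apply_univ (hw0 : ∀ y, 0 < w y) (P : Kernel Ω Ω)
    (hP : ∀ (x : Ω) {B : Set Ω}, MeasurableSet B → P x B =
      ∫⁻ y, ∑ J : Fin n, ENNReal.ofReal (w (Fin.cons (α := fun _ : Fin (n + 1) => Ω) x y J.succ)) *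
          B.indicator (fun _ => (1 : ℝ≥0∞)) (Fin.cons (α := fun _ : Fin (n + 1) => Ω) x y J.succ) *
          min (∑ i ∈ univ.erase 0, ENNReal.ofReal (w (Fin.cons (α := fun _ : Fin (n + 1) => Ω) x y i)))⁻¹
            (∑ i ∈ univ.erase J.succ, ENNReal.ofReal (w (Fin.cons (α := fun _ : Fin (n + 1) => Ω) x y i)))⁻¹ ∂(Measure.pi fun _ : Fin n => q) +
        (1 - ∫⁻ y, ∑ J : Fin n, ENNReal.ofReal (w (Fin.cons (α := fun _ : Fin (n + 1) => Ω) x y J.succ)) *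
          min (∑ i ∈ univ.erase 0, ENNReal.ofReal (w (Fin.cons (α := fun _ : Fin (n + 1) => Ω) x y i)))⁻¹
            (∑ i ∈ univ.erase J.succ, ENNReal.ofReal (w (Fin.cons (α := fun _ : Fin (n + 1) => Ω) x y i)))⁻¹ ∂(Measure.pi fun _ : Fin n => q)) *
          B.indicator 1 x)
    (x : Ω) : P x Set.univ = 1 := by
  rw [hP x MeasurableSet.univ]
  simp only [Set.indicator_univ, mul_one, Pi.one_apply]
  refine add_tsub_cancel_of_le ?_
  calc ∫⁻ y, ∑ J : Fin n, ENNReal.ofReal (w (Fin.cons (α := fun _ : Fin (n + 1) => Ω) x y J.succ)) *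
          min (∑ i ∈ univ.erase 0, ENNReal.ofReal (w (Fin.cons (α := fun _ : Fin (n + 1) => Ω) x y i)))⁻¹
            (∑ i ∈ univ.erase J.succ, ENNReal.ofReal (w (Fin.cons (α := fun _ : Fin (n + 1) => Ω) x y i)))⁻¹ ∂(Measure.pi fun _ : Fin n => q)
      ≤ ∫⁻ _, 1 ∂(Measure.pi fun _ : Fin n => q) := lintegral_mono fun y => mtm_move_le_one hw0 x y
    _ = 1 := by rw [lintegral_const, measure_univ, mul_one]

/-- **`π` IS INVARIANT FOR THE MULTIPLE-TRY FLOW SAMPLER**: `∫ P(x, B) π(dx) = π(B)` for every measurable `B`. [ours] -/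
theorem mtm_invariant (hw : Measurable w) (hw0 : ∀ y, 0 < w y) (P : Kernel Ω Ω)
    (hP : ∀ (x : Ω) {B : Set Ω}, MeasurableSet B → P x B =
      ∫⁻ y, ∑ J : Fin n, ENNReal.ofReal (w (Fin.cons (α := fun _ : Fin (n + 1) => Ω) x y J.succ)) *
          B.indicator (fun _ => (1 : ℝ≥0∞)) (Fin.cons (α := fun _ : Fin (n + 1) => Ω) x y J.succ) *
          min (∑ i ∈ univ.erase 0, ENNReal.ofReal (w (Fin.cons (α := fun _ : Fin (n + 1) => Ω) x y i)))⁻¹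
            (∑ i ∈ univ.erase J.succ, ENNReal.ofReal (w (Fin.cons (α := fun _ : Fin (n + 1) => Ω) x y i)))⁻¹ ∂(Measure.pi fun _ : Fin n => q) +
        (1 - ∫⁻ y, ∑ J : Fin n, ENNReal.ofReal (w (Fin.cons (α := fun _ : Fin (n + 1) => Ω) x y J.succ)) *
          min (∑ i ∈ univ.erase 0, ENNReal.ofReal (w (Fin.cons (α := fun _ : Fin (n + 1) => Ω) x y i)))⁻¹
            (∑ i ∈ univ.erase J.succ, ENNReal.ofReal (w (Fin.cons (α := fun _ : Fin (n + 1) => Ω) x y i)))⁻¹ ∂(Measure.pi fun _ : Fin n => q)) *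
          B.indicator 1 x)
    {B : Set Ω} (hB : MeasurableSet B) :
    ∫⁻ x, P x B ∂(q.withDensity fun x => ENNReal.ofReal (w x)) = (q.withDensity fun x => ENNReal.ofReal (w x)) B := by
  set π : Measure Ω := q.withDensity fun x => ENNReal.ofReal (w x) with hπ
  calc ∫⁻ x, P x B ∂π = ∫⁻ x in Set.univ, P x B ∂π := by rw [Measure.restrict_univ]
    _ = ∫⁻ x in B, P x Set.univ ∂π := mtm_detailedBalance hw P hP MeasurableSet.univ hB
    _ = ∫⁻ x in B, 1 ∂π := by simp_rw [mtm_apply_univ hw0 P hP]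
    _ = π B := by rw [setLIntegral_const, one_mul]

/-! ## §5 The multiple-try rule moves at least as much as pool selection -/

omit [MeasurableSpace Ω] in
/-- Pointwise: the pool-selection weight `1/W` is at most the multiple-try factor `min(S_0⁻¹, S_j⁻¹)` (both leave-one-out weights are `≤ W`).
[ours, bookkeeping] -/
theorem inv_poolWeight_le_mtmFactor (j : Fin (n + 1)) (z : Fin (n + 1) → Ω) :
    (∑ i, ENNReal.ofReal (w (z i)))⁻¹ ≤
      min (∑ i ∈ univ.erase 0, ENNReal.ofReal (w (z i)))⁻¹ (∑ i ∈ univ.erase j, ENNReal.ofReal (w (z i)))⁻¹ :=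
  le_min (ENNReal.inv_le_inv.2 (sum_le_sum_of_subset (erase_subset _ _)))
    (ENNReal.inv_le_inv.2 (sum_le_sum_of_subset (erase_subset _ _)))

omit [IsProbabilityMeasure q] in
/-- **THE MULTIPLE-TRY KERNEL DOMINATES THE POOL-SELECTION KERNEL OFF THE CURRENT STATE**: for the same flow, weight and batch size `n`, and every
measurable `B ∌ x`, `P_pool(x, B) ≤ P_MTM(x, B)` — from every configuration the multiple-try rule moves into every set at least as often as
GEN-41's pool selection (the hypothesis of the Peskun–Tierney ordering of two `π`-reversible kernels). [ours] -/
theorem multiProposal_apply_le_mtm_apply (P Pm : Kernel Ω Ω)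
    (hP : ∀ (x : Ω) {B : Set Ω}, MeasurableSet B → P x B = ∫⁻ y, (∑ j, ENNReal.ofReal (w (Fin.cons (α := fun _ : Fin (n + 1) => Ω) x y j)) *
      B.indicator (fun _ => (1 : ℝ≥0∞)) (Fin.cons (α := fun _ : Fin (n + 1) => Ω) x y j)) /
      (∑ i, ENNReal.ofReal (w (Fin.cons (α := fun _ : Fin (n + 1) => Ω) x y i))) ∂(Measure.pi fun _ : Fin n => q))
    (hPm : ∀ (x : Ω) {B : Set Ω}, MeasurableSet B → Pm x B =
      ∫⁻ y, ∑ J : Fin n, ENNReal.ofReal (w (Fin.cons (α := fun _ : Fin (n + 1) => Ω) x y J.succ)) *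
          B.indicator (fun _ => (1 : ℝ≥0∞)) (Fin.cons (α := fun _ : Fin (n + 1) => Ω) x y J.succ) *
          min (∑ i ∈ univ.erase 0, ENNReal.ofReal (w (Fin.cons (α := fun _ : Fin (n + 1) => Ω) x y i)))⁻¹
            (∑ i ∈ univ.erase J.succ, ENNReal.ofReal (w (Fin.cons (α := fun _ : Fin (n + 1) => Ω) x y i)))⁻¹ ∂(Measure.pi fun _ : Fin n => q) +
        (1 - ∫⁻ y, ∑ J : Fin n, ENNReal.ofReal (w (Fin.cons (α := fun _ : Fin (n + 1) => Ω) x y J.succ)) *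
          min (∑ i ∈ univ.erase 0, ENNReal.ofReal (w (Fin.cons (α := fun _ : Fin (n + 1) => Ω) x y i)))⁻¹
            (∑ i ∈ univ.erase J.succ, ENNReal.ofReal (w (Fin.cons (α := fun _ : Fin (n + 1) => Ω) x y i)))⁻¹ ∂(Measure.pi fun _ : Fin n => q)) *
          B.indicator 1 x)
    {x : Ω} {B : Set Ω} (hB : MeasurableSet B) (hx : x ∉ B) : P x B ≤ Pm x B := by
  rw [hP x hB, hPm x hB, Set.indicator_of_notMem hx, mul_zero, add_zero]
  refine lintegral_mono fun y => ?_
  -- split the pool-selection numerator over the pool; the current state's term vanishes off `B`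
  rw [Fin.sum_univ_succ]
  simp only [Fin.cons_zero, Set.indicator_of_notMem hx, mul_zero, zero_add, ENNReal.div_eq_inv_mul, Finset.mul_sum]
  refine sum_le_sum fun J _ => ?_
  rw [mul_comm]
  exact mul_le_mul' le_rfl (inv_poolWeight_le_mtmFactor J.succ _)

end Summit.Ventures.LatticeQCDFlow.Exactness
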